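import Summits.ValiantsHypothesis.ValiantsHypothesis.Theorems.DefinabilityGapZeroPatternPermanent
import HarnessLib

/-!
# DefinabilityGap — ADMISSIBLE BLOCKS of a cell set, stage H1a (combinatorics of the block census)

Route `route-ValiantsHypothesis-DefinabilityGap` (DRAFT), read-once leaf F4 / W10 (aside `KIPlantedHittingRO`,
stmt-ValiantsHypothesis-23704), leaf `ZperHits₂(m)` = hypothesis `hZ` of
`DefinabilityGapZperTransfer.chainVal_eq_zero_of_bind₁_kiPer`; census cell F4/W10 rung_ladder.next ‖ v35
«δ-parameter: minimal number / placement of the non-unit links of a void» (decomp-valiant bus, OFFER O-L5-BK;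
file H1a of the series H1a / H1b / H2 / H3). g23 (E1–E3) gave: the non-unit labels of a void escape every `m - 2`
cells (`|T| ≥ m - 1`, LINEAR in `m`). This series: a QUADRATIC bound `m(m - c) ≤ 2·|T|` whenever a permutation
avoids the non-unit support `T` (H3), from the BLOCK CENSUS of `T` set up here.

**THIS FILE** (pure combinatorics of a cell set `T ⊆ m × m`; no chains). `avoid T` = the permutations `ρ` with all
cells `(ρ i, i)` off `T` (E1). ADMISSIBLE CELLS `adm T` = the cells of the avoiding permutations (= the variables of
the zero-pattern permanent `Q_T`, `vars_zpPer_eq_adm`); two rows are TIED when they carry admissible cells in a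
common column; the classes of the equivalence closure are the ROW BLOCKS `R_[a] = rowBlock T a`, with COLUMN BLOCKS
`C_[a] = colBlock T a` (the columns of the admissible cells of `R_[a]`). When some permutation avoids `T`:
* BALANCE: every avoiding permutation maps `C_[a]` onto `R_[a]` (`mem_colBlock_iff_apply_mem_rowBlock`,
  `card_colBlock`) — the blocks are the fully indecomposable components of the pattern `Tᶜ`;
* SURPLUS (`card_lt_card_neighbours`): a proper non-empty set `X ⊊ R_[a]` of rows has at least `|X| + 1` block
  columns joined to it by off-`T` cells (if `|N(X)| = |X|` then `N(X) = ρ⁻¹(X)` for EVERY avoiding `ρ`, so `X` is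
  closed under ties — against connectivity); hence NEAR-PERFECT MATCHINGS (`exists_nearMatching`, Hall's theorem
  from Mathlib): deleting any row and any column of a block leaves a system of distinct off-`T` representatives;
H1b (`DefinabilityGapBlockExclusion`) continues with two-cycle exclusion, the quadratic count and Frobenius–König.

HONEST PLACEMENT. KNOWN mathematics: the blocks are the fully indecomposable components of the Dulmage–Mendelsohn /
Brualdi canonical form [cite: BrualdiRyser1991, Thm. 4.2.6, Thm. 4.2.7]; the surplus / near-matching statements
are the "elementary bipartite graph" property of those components, with Hall's theorem taken from Mathlib
(`Finset.all_card_le_biUnion_card_iff_exists_injective`). Kernel-new bookkeeping only; closes NO item;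
0 S-currency; rung 0; VP ≠ VNP untouched. No facts, no Prop-valued definitions, no placeholders; data definitions
`adm`, `ties`, `rowBlock`, `colBlock`.
-/

set_option linter.dupNamespace false

open MvPolynomial Finset
open Literature.Computability.AlgebraicComplexity
open Summit.ValiantsHypothesis.ValiantsHypothesis.Theorems.DefinabilityGapZeroPatternPermanent

namespace Summit.ValiantsHypothesis.ValiantsHypothesis.Theorems.DefinabilityGapAdmissibleBlocks

noncomputable section

variable {m : ℕ}

/-! ## 1. Admissible cells -/

/-- ADMISSIBLE CELLS of `T`: the cells `(ρ i, i)` of the `T`-avoiding permutations `ρ`.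
[cite: BrualdiRyser1991, Thm. 4.2.6] -/
def adm (T : Finset (Fin m × Fin m)) : Finset (Fin m × Fin m) :=
  univ.filter fun x => ∃ ρ ∈ avoid T, ρ x.2 = x.1

/-- Membership in `adm T`. [this file] -/
theorem mem_adm {T : Finset (Fin m × Fin m)} {x : Fin m × Fin m} :
    x ∈ adm T ↔ ∃ ρ ∈ avoid T, ρ x.2 = x.1 := by
  simp [adm]

/-- Membership in `adm T`, pair form. [this file] -/
theorem mk_mem_adm {T : Finset (Fin m × Fin m)} {k i : Fin m} :
    (k, i) ∈ adm T ↔ ∃ ρ ∈ avoid T, ρ i = k := by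
  simp [adm]

/-- The cells of an avoiding permutation are admissible. [this file] -/
theorem apply_mem_adm {T : Finset (Fin m × Fin m)} {ρ : Equiv.Perm (Fin m)} (hρ : ρ ∈ avoid T)
    (i : Fin m) : (ρ i, i) ∈ adm T :=
  mk_mem_adm.2 ⟨ρ, hρ, rfl⟩

/-- Admissible cells lie off `T`. [this file] -/
theorem not_mem_of_mem_adm {T : Finset (Fin m × Fin m)} {x : Fin m × Fin m} (hx : x ∈ adm T) : x ∉ T := by
  obtain ⟨k, i⟩ := x
  obtain ⟨ρ, hρ, rfl⟩ := mk_mem_adm.1 hx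
  exact (mem_avoid.1 hρ) i

/-- The admissible cells are the variables of `Q_T` (nontrivial coefficients). [this file] -/
theorem vars_zpPer_eq_adm (R : Type*) [CommSemiring R] [Nontrivial R] (T : Finset (Fin m × Fin m)) :
    (zpPer R T).vars = adm T := by
  classical
  ext ⟨k, i⟩
  rw [mem_vars_iff_mem_support, mk_mem_adm]
  constructor
  · rintro ⟨d, hd, hx⟩
    obtain ⟨ρ, hρ, rfl⟩ := exists_perm_of_coeff_zpPer_ne_zero R (mem_support_iff.1 hd)
    refine ⟨ρ, hρ, ?_⟩
    rw [Finsupp.mem_support_iff, permMonomial_apply] at hx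
    by_contra h; exact hx (if_neg h)
  · rintro ⟨ρ, hρ, hρx⟩
    refine ⟨permMonomial ρ, ?_, ?_⟩
    · rw [mem_support_iff, coeff_permMonomial_zpPer, if_pos hρ]; exact one_ne_zero
    · rw [Finsupp.mem_support_iff, permMonomial_apply, if_pos hρx]; exact one_ne_zero

/-! ## 2. Ties, row blocks, column blocks -/

/-- TIES: the ordered pairs of rows carrying admissible cells in a common column. [this file] -/
def ties (T : Finset (Fin m × Fin m)) : Finset (Fin m × Fin m) :=
  univ.filter fun p => ∃ b, (p.1, b) ∈ adm T ∧ (p.2, b) ∈ adm T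

/-- Membership in `ties T`. [this file] -/
theorem mem_ties {T : Finset (Fin m × Fin m)} {a a' : Fin m} :
    (a, a') ∈ ties T ↔ ∃ b, (a, b) ∈ adm T ∧ (a', b) ∈ adm T := by
  simp [ties]

/-- Ties are symmetric. [this file] -/
theorem mem_ties_comm {T : Finset (Fin m × Fin m)} {a a' : Fin m} :
    (a, a') ∈ ties T ↔ (a', a) ∈ ties T := by
  rw [mem_ties, mem_ties]
  exact exists_congr fun b => and_comm

open scoped Classical in
/-- The ROW BLOCK of the row `a`: the rows LINKED to `a`, i.e. related to `a` by the equivalence closure of the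
ties. [cite: BrualdiRyser1991, Thm. 4.2.7] -/
def rowBlock (T : Finset (Fin m × Fin m)) (a : Fin m) : Finset (Fin m) :=
  univ.filter fun a' => Relation.EqvGen (fun x y => (x, y) ∈ ties T) a a'

/-- The COLUMN BLOCK of the row `a`: the columns of the admissible cells of the rows linked to `a`.
[cite: BrualdiRyser1991, Thm. 4.2.7] -/
def colBlock (T : Finset (Fin m × Fin m)) (a : Fin m) : Finset (Fin m) :=
  univ.filter fun b => ∃ a' ∈ rowBlock T a, (a', b) ∈ adm T

/-- Membership in a row block. [this file] -/
theorem mem_rowBlock {T : Finset (Fin m × Fin m)} {a a' : Fin m} :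
    a' ∈ rowBlock T a ↔ Relation.EqvGen (fun x y => (x, y) ∈ ties T) a a' := by
  simp [rowBlock]

/-- Membership in a column block. [this file] -/
theorem mem_colBlock {T : Finset (Fin m × Fin m)} {a b : Fin m} :
    b ∈ colBlock T a ↔ ∃ a' ∈ rowBlock T a, (a', b) ∈ adm T := by
  simp [colBlock]

/-- A row lies in its own block. [this file] -/
theorem self_mem_rowBlock (T : Finset (Fin m × Fin m)) (a : Fin m) : a ∈ rowBlock T a :=
  mem_rowBlock.2 (Relation.EqvGen.refl a)

/-- Tied rows are linked. [this file] -/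
theorem mem_rowBlock_of_mem_ties {T : Finset (Fin m × Fin m)} {a a' : Fin m} (h : (a, a') ∈ ties T) :
    a' ∈ rowBlock T a :=
  mem_rowBlock.2 (Relation.EqvGen.rel a a' h)

/-- Linkage is symmetric. [this file] -/
theorem mem_rowBlock_comm {T : Finset (Fin m × Fin m)} {a a' : Fin m} :
    a' ∈ rowBlock T a ↔ a ∈ rowBlock T a' :=
  ⟨fun h => mem_rowBlock.2 (Relation.EqvGen.symm _ _ (mem_rowBlock.1 h)),
    fun h => mem_rowBlock.2 (Relation.EqvGen.symm _ _ (mem_rowBlock.1 h))⟩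

/-- Linked rows have the same row block … [this file] -/
theorem rowBlock_eq_of_mem {T : Finset (Fin m × Fin m)} {a a' : Fin m} (h : a' ∈ rowBlock T a) :
    rowBlock T a' = rowBlock T a := by
  ext x
  rw [mem_rowBlock, mem_rowBlock]
  exact ⟨fun hx => Relation.EqvGen.trans _ _ _ (mem_rowBlock.1 h) hx,
    fun hx => Relation.EqvGen.trans _ _ _ (Relation.EqvGen.symm _ _ (mem_rowBlock.1 h)) hx⟩

/-- … and the same column block. [this file] -/
theorem colBlock_eq_of_mem {T : Finset (Fin m × Fin m)} {a a' : Fin m} (h : a' ∈ rowBlock T a) :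
    colBlock T a' = colBlock T a := by
  unfold colBlock
  rw [rowBlock_eq_of_mem h]

/-- CLOSURE (the induction principle of blocks): a set of rows containing `a` and closed under ties contains the
row block of `a`. [this file] -/
theorem rowBlock_subset_of_closed {T : Finset (Fin m × Fin m)} {a : Fin m} {X : Finset (Fin m)} (ha : a ∈ X)
    (hX : ∀ x y, (x, y) ∈ ties T → x ∈ X → y ∈ X) : rowBlock T a ⊆ X := by
  have key : ∀ {x y : Fin m}, Relation.EqvGen (fun x y => (x, y) ∈ ties T) x y → (x ∈ X ↔ y ∈ X) := by
    intro x y h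
    induction h with
    | rel x y hxy => exact ⟨hX x y hxy, hX y x (mem_ties_comm.1 hxy)⟩
    | refl x => exact Iff.rfl
    | symm x y _ ih => exact ih.symm
    | trans x y z _ _ ih₁ ih₂ => exact ih₁.trans ih₂
  intro x hx
  exact (key (mem_rowBlock.1 hx)).1 ha

/-- An admissible cell in a block row has a block column. [this file] -/
theorem snd_mem_colBlock {T : Finset (Fin m × Fin m)} {a : Fin m} {x : Fin m × Fin m} (hx : x ∈ adm T)
    (h : x.1 ∈ rowBlock T a) : x.2 ∈ colBlock T a :=
  mem_colBlock.2 ⟨x.1, h, hx⟩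

/-- Two rows whose column blocks meet are linked. [this file] -/
theorem mem_rowBlock_of_mem_colBlock {T : Finset (Fin m × Fin m)} {a a' b : Fin m} (h : b ∈ colBlock T a)
    (h' : b ∈ colBlock T a') : a' ∈ rowBlock T a := by
  obtain ⟨x, hx, hxb⟩ := mem_colBlock.1 h
  obtain ⟨x', hx', hx'b⟩ := mem_colBlock.1 h'
  have hxx' : x' ∈ rowBlock T x := mem_rowBlock_of_mem_ties (mem_ties.2 ⟨b, hxb, hx'b⟩)
  rw [rowBlock_eq_of_mem hx] at hxx'
  rw [← rowBlock_eq_of_mem hxx', rowBlock_eq_of_mem hx']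
  exact self_mem_rowBlock T a'

/-- Distinct blocks have disjoint rows … [this file] -/
theorem disjoint_rowBlock {T : Finset (Fin m × Fin m)} {a a' : Fin m} (h : a' ∉ rowBlock T a) :
    Disjoint (rowBlock T a) (rowBlock T a') :=
  disjoint_left.2 fun x hx hx' => h (by
    rw [← rowBlock_eq_of_mem hx, mem_rowBlock_comm]
    exact hx')

/-- … and disjoint columns. [this file] -/
theorem disjoint_colBlock {T : Finset (Fin m × Fin m)} {a a' : Fin m} (h : a' ∉ rowBlock T a) :
    Disjoint (colBlock T a) (colBlock T a') :=
  disjoint_left.2 fun _ hb hb' => h (mem_rowBlock_of_mem_colBlock hb hb')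

/-- Every avoiding permutation maps the column block into the row block … [this file] -/
theorem apply_mem_rowBlock {T : Finset (Fin m × Fin m)} {σ : Equiv.Perm (Fin m)} (hσ : σ ∈ avoid T)
    {a b : Fin m} (hb : b ∈ colBlock T a) : σ b ∈ rowBlock T a := by
  obtain ⟨x, hx, hxb⟩ := mem_colBlock.1 hb
  rw [← rowBlock_eq_of_mem hx]
  exact mem_rowBlock_of_mem_ties (mem_ties.2 ⟨b, hxb, apply_mem_adm hσ b⟩)

/-- … and its inverse maps the row block into the column block. [this file] -/
theorem symm_apply_mem_colBlock {T : Finset (Fin m × Fin m)} {σ : Equiv.Perm (Fin m)} (hσ : σ ∈ avoid T)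
    {a a' : Fin m} (ha' : a' ∈ rowBlock T a) : σ.symm a' ∈ colBlock T a :=
  mem_colBlock.2 ⟨a', ha', by simpa using apply_mem_adm hσ (σ.symm a')⟩

/-- The column block is the preimage of the row block under any avoiding permutation. [this file] -/
theorem mem_colBlock_iff_apply_mem_rowBlock {T : Finset (Fin m × Fin m)} {σ : Equiv.Perm (Fin m)}
    (hσ : σ ∈ avoid T) {a b : Fin m} : b ∈ colBlock T a ↔ σ b ∈ rowBlock T a :=
  ⟨apply_mem_rowBlock hσ, fun h => by simpa using symm_apply_mem_colBlock hσ h⟩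

/-- BLOCKS ARE BALANCED (as soon as some permutation avoids `T`). [cite: BrualdiRyser1991, Thm. 4.2.6] -/
theorem card_colBlock {T : Finset (Fin m × Fin m)} (h0 : (avoid T).Nonempty) (a : Fin m) :
    (colBlock T a).card = (rowBlock T a).card := by
  obtain ⟨σ, hσ⟩ := h0
  exact card_nbij' (fun b => σ b) (fun x => σ.symm x) (fun b hb => apply_mem_rowBlock hσ hb)
    (fun x hx => symm_apply_mem_colBlock hσ hx) (fun b _ => by simp) (fun x _ => by simp)

/-! ## 3. Surplus and near-perfect matchings -/

/-- SURPLUS (every block is fully indecomposable): inside a block, a proper non-empty set of rows has MORE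
off-`T` neighbour columns in the block than rows. [cite: BrualdiRyser1991, Thm. 4.2.7] -/
theorem card_lt_card_neighbours {T : Finset (Fin m × Fin m)} (h0 : (avoid T).Nonempty) {a : Fin m}
    {X : Finset (Fin m)} (hX : X ⊆ rowBlock T a) (hne : X.Nonempty) (hpr : X ≠ rowBlock T a) :
    X.card < ((colBlock T a).filter fun b => ∃ x ∈ X, (x, b) ∉ T).card := by
  -- every avoiding `σ` injects `X` into the neighbour set by `σ⁻¹`
  have himg : ∀ σ ∈ avoid T, X.image σ.symm ⊆ (colBlock T a).filter fun b => ∃ x ∈ X, (x, b) ∉ T := by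
    intro σ hσ b hb
    obtain ⟨x, hx, rfl⟩ := mem_image.1 hb
    exact mem_filter.2 ⟨symm_apply_mem_colBlock hσ (hX hx), x, hx, by
      simpa using (mem_avoid.1 hσ) (σ.symm x)⟩
  have hcard : ∀ σ : Equiv.Perm (Fin m), (X.image σ.symm).card = X.card := fun σ =>
    card_image_of_injective _ σ.symm.injective
  obtain ⟨σ₀, hσ₀⟩ := h0
  have hle : X.card ≤ ((colBlock T a).filter fun b => ∃ x ∈ X, (x, b) ∉ T).card :=
    (hcard σ₀) ▸ card_le_card (himg σ₀ hσ₀)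
  refine lt_of_le_of_ne hle fun heq => hpr ?_
  -- equality: the neighbour set is `σ⁻¹(X)` for EVERY avoiding `σ`, so `X` is closed under ties
  have hfull : ∀ σ ∈ avoid T, X.image σ.symm = (colBlock T a).filter fun b => ∃ x ∈ X, (x, b) ∉ T :=
    fun σ hσ => eq_of_subset_of_card_le (himg σ hσ) (by rw [hcard, heq])
  have hclosed : ∀ x y, (x, y) ∈ ties T → x ∈ X → y ∈ X := by
    intro x y hxy hx
    obtain ⟨b, hxb, hyb⟩ := mem_ties.1 hxy
    obtain ⟨ρ, hρ, hρb⟩ := mk_mem_adm.1 hxb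
    obtain ⟨ρ', hρ', hρ'b⟩ := mk_mem_adm.1 hyb
    have hb : b ∈ X.image ρ'.symm := by
      rw [hfull ρ' hρ', ← hfull ρ hρ]
      exact mem_image.2 ⟨x, hx, by rw [← hρb, Equiv.symm_apply_apply]⟩
    obtain ⟨x', hx', hx'b⟩ := mem_image.1 hb
    have : x' = y := by rw [← hρ'b, ← hx'b, Equiv.apply_symm_apply]
    exact this ▸ hx'
  obtain ⟨x₀, hx₀⟩ := hne
  refine Subset.antisymm hX ?_
  rw [← rowBlock_eq_of_mem (hX hx₀)]
  exact rowBlock_subset_of_closed hx₀ hclosed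

/-- SURPLUS, column form with one row and one column deleted (the Hall condition for near-perfect matchings).
[this file] -/
theorem card_le_card_neighbours_erase {T : Finset (Fin m × Fin m)} (h0 : (avoid T).Nonempty)
    {a a₀ b₀ : Fin m} (ha₀ : a₀ ∈ rowBlock T a) (hb₀ : b₀ ∈ colBlock T a) {Y : Finset (Fin m)}
    (hY : Y ⊆ (colBlock T a).erase b₀) :
    Y.card ≤ (((rowBlock T a).erase a₀).filter fun x => ∃ y ∈ Y, (x, y) ∉ T).card := by
  have _ := ha₀ -- (`a₀ ∈ R_[a]` is not needed: erasing a foreign row changes nothing)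
  rcases Y.eq_empty_or_nonempty with rfl | ⟨y₁, hy₁⟩
  · simp
  have hpart : ((rowBlock T a).filter fun x => ∃ y ∈ Y, (x, y) ∉ T).card +
      ((rowBlock T a).filter fun x => ¬ ∃ y ∈ Y, (x, y) ∉ T).card = (rowBlock T a).card :=
    card_filter_add_card_filter_not _
  have hcb : (colBlock T a).card = (rowBlock T a).card := card_colBlock h0 a
  have hYc : Y.card + 1 ≤ (colBlock T a).card := by
    have h1 := card_le_card hY
    rw [card_erase_of_mem hb₀] at h1
    have h2 : 0 < (colBlock T a).card := card_pos.2 ⟨b₀, hb₀⟩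
    omega
  -- the rows of the block NOT joined to `Y`: empty, or a proper subset with surplus
  have hmain : Y.card + 1 ≤ ((rowBlock T a).filter fun x => ∃ y ∈ Y, (x, y) ∉ T).card := by
    by_cases hX0 : ((rowBlock T a).filter fun x => ¬ ∃ y ∈ Y, (x, y) ∉ T) = ∅
    · rw [hX0, card_empty, add_zero] at hpart; omega
    obtain ⟨σ₀, hσ₀⟩ := h0
    have hy₁c : y₁ ∈ colBlock T a := mem_of_mem_erase (hY hy₁)
    have hXpr : ((rowBlock T a).filter fun x => ¬ ∃ y ∈ Y, (x, y) ∉ T) ≠ rowBlock T a := by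
      intro hXe
      have hmem : σ₀ y₁ ∈ (rowBlock T a).filter fun x => ¬ ∃ y ∈ Y, (x, y) ∉ T := by
        rw [hXe]; exact apply_mem_rowBlock hσ₀ hy₁c
      exact (mem_filter.1 hmem).2 ⟨y₁, hy₁, (mem_avoid.1 hσ₀) y₁⟩
    have hsur := card_lt_card_neighbours ⟨σ₀, hσ₀⟩ (filter_subset _ (rowBlock T a))
      (nonempty_iff_ne_empty.2 hX0) hXpr
    have hNX : ((colBlock T a).filter fun b =>
        ∃ x ∈ (rowBlock T a).filter (fun x => ¬ ∃ y ∈ Y, (x, y) ∉ T), (x, b) ∉ T) ⊆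
      colBlock T a \ Y := by
      intro b hb
      obtain ⟨hbc, x, hx, hxb⟩ := mem_filter.1 hb
      exact mem_sdiff.2 ⟨hbc, fun hbY => (mem_filter.1 hx).2 ⟨b, hbY, hxb⟩⟩
    have hD : (colBlock T a \ Y).card + Y.card = (colBlock T a).card :=
      card_sdiff_add_card_eq_card (hY.trans (erase_subset _ _))
    have := card_le_card hNX
    omega
  have hsub : ((rowBlock T a).filter fun x => ∃ y ∈ Y, (x, y) ∉ T).erase a₀ ⊆
      ((rowBlock T a).erase a₀).filter fun x => ∃ y ∈ Y, (x, y) ∉ T := by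
    intro x hx
    obtain ⟨hxa, hxN⟩ := mem_erase.1 hx
    obtain ⟨hxr, hP⟩ := mem_filter.1 hxN
    exact mem_filter.2 ⟨mem_erase.2 ⟨hxa, hxr⟩, hP⟩
  have h1 := pred_card_le_card_erase (s := (rowBlock T a).filter fun x => ∃ y ∈ Y, (x, y) ∉ T) (a := a₀)
  have h2 := card_le_card hsub
  omega

/-- NEAR-PERFECT MATCHINGS (Hall): delete a row `a₀` and a column `b₀` of a block — the rest of the block still
has a system of distinct off-`T` representatives. [cite: BrualdiRyser1991, Thm. 4.2.7] -/
theorem exists_nearMatching {T : Finset (Fin m × Fin m)} (h0 : (avoid T).Nonempty) {a a₀ b₀ : Fin m}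
    (ha₀ : a₀ ∈ rowBlock T a) (hb₀ : b₀ ∈ colBlock T a) :
    ∃ f : ((colBlock T a).erase b₀ : Finset (Fin m)) → Fin m, Function.Injective f ∧
      ∀ y, f y ∈ (rowBlock T a).erase a₀ ∧ (f y, (y : Fin m)) ∉ T := by
  have hall : ∀ s : Finset ((colBlock T a).erase b₀ : Finset (Fin m)),
      s.card ≤ (s.biUnion fun y => ((rowBlock T a).erase a₀).filter fun x => (x, (y : Fin m)) ∉ T).card := by
    intro s
    have hYs : s.image Subtype.val ⊆ (colBlock T a).erase b₀ := by
      intro y hy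
      obtain ⟨y', -, rfl⟩ := mem_image.1 hy
      exact y'.2
    have h := card_le_card_neighbours_erase h0 ha₀ hb₀ hYs
    rw [card_image_of_injective _ Subtype.val_injective] at h
    refine h.trans (card_le_card fun x hx => ?_)
    obtain ⟨hxr, y, hy, hxy⟩ := mem_filter.1 hx
    obtain ⟨y', hy', rfl⟩ := mem_image.1 hy
    exact mem_biUnion.2 ⟨y', hy', mem_filter.2 ⟨hxr, hxy⟩⟩
  obtain ⟨f, hf, hft⟩ := (all_card_le_biUnion_card_iff_exists_injective _).1 hall
  exact ⟨f, hf, fun y => mem_filter.1 (hft y)⟩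

end

end Summit.ValiantsHypothesis.ValiantsHypothesis.Theorems.DefinabilityGapAdmissibleBlocks
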